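import Literature.Analysis.FluidPDE.PassiveVectorTensorRestart
import Literature.Analysis.FunctionSpaces.TorusDerivBounds
import HarnessLib

/-!
# Weak passive solenoidal vectors with a DISTORTED constant viscosity tensor (Lagrangian
# coordinates): the conjugated tensor `𝔸^G`, the divergence-form test operator, time-Lipschitz
# test fields, and the weak class `Torus.IsWeakTensorPassiveVectorDistortedOn`

Analysis/FluidPDE support file (definitions + unfolding / bridge lemmas; no facts).

Conjugating the constant-tensor passive-vector equation
`∂ₜu + (b·∇)u + A (u·∇)b + ∇π = 𝓛_𝔸 u`, `∇·u = 0` (`(𝓛_𝔸 u)_i = Σ_{a,j,b} 𝔸 i a j b ∂_a ∂_b u_j`,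
class `Torus.IsWeakTensorPassiveVectorOn`) by the Lagrangian flow `X` of a slow carrier —
`ũ(t, y) = u(t, X(t, y))`, compositions in the space variable only — replaces, with
`G := (∇X)⁻¹` (`G_{ca} = ((∇X)⁻¹)_{ca}`, so that `(∂_a u_j) ∘ X = Σ_c G_{ca} ∂_c ũ_j`):
* the constraint `∇·u = 0` by `∇·(G ũ) = 0` (the pull-back `X^* u = (∇X)⁻¹ u ∘ X` of a solenoidal
  field by a volume-preserving map is solenoidal);
* the constant-coefficient viscous term by the DIVERGENCE-FORM operator with the `y`-dependent
  CONJUGATED TENSOR `(𝔸^G)_{icjd} = Σ_{a,b} G_{ca} 𝔸_{iajb} G_{db}`: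
  `−∫ Σ 𝔸_{iajb} ∂_b u_j ∂_a φ_i dx = −∫ Σ (𝔸^G)_{icjd} ∂_c φ̃_i ∂_d ũ_j dy`, i.e. on the test side
  `(𝓛^{G,*} φ̃)_j = Σ_{i,c,d} ∂_d((𝔸^G)_{icjd} ∂_c φ̃_i)` (`Torus.viscAdjVar`), which for `G ≡ 1` is
  `viscAdj 𝔸` (`viscAdjVar_const`);
* the test class by fields `Ψ` with `∇·(G Ψ) = 0`, smooth in `y` but only LIPSCHITZ in `t`
  (`G = (∇X)⁻¹` is only Lipschitz in `t` when the carrier is bounded measurable in time, so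
  `t`-smooth tests with `∇·(G(t)Ψ(t)) = 0` are scarce): `Torus.IsLipschitzSpaceTimeTest`.
This is the passive-VECTOR, fourth-order-tensor analogue of Armstrong–Vicol's "distortion of the
diffusion by the inverse flows": the matrix `s_{m−1} = K_m Σ_l ξ̂_{m,l} (∇X_{m−1,l} ∘ X_{m−1,l}⁻¹ − I₂)`
added to the diffusivity in the equation `∂ₜT − ∇·((K_m + s_{m−1})∇T) + b_{m−1}·∇T = 0` for the
Lagrangian-coordinate ansatz (arXiv:2305.05048, §4.1, PDF p. 34), written for Frisch's eddy-viscosity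
tensor (9.57) and Giaquinta's variable-coefficient systems in divergence form
`−D_α(A^{αβ}_{ij}(x) D_β u^j)` (Ch. III §2 (2.1)–(2.3)).

Contents: `Visc4.conj`, `Torus.distort`, `Torus.viscAdjVar` (+ coordinates, `G ≡ 1` reductions),
`Torus.IsLipschitzSpaceTimeTest` (+ every smooth space–time test field is one),
`Torus.IsWeakTensorPassiveVectorDistortedOn A T 𝔸 b G w₀ w` (the unforced class VERBATIM except:
constraint `∇·(G w) = 0`, Lipschitz-in-time tests with `∇·(G Ψ) = 0`, viscous term `viscAdjVar (𝔸^G)`),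
its kinematic API, and the bridge `G ≡ 1 ⇒ Torus.IsWeakTensorPassiveVectorOn` (restriction of the
test class; the converse needs the flat weak formulation for time-Lipschitz tests — time mollification —
and is filed separately).

Consumer: S1′ (`stub_conjugateL`: the conjugate of a flat solution is a distorted solution) and S2′
(rate-error cell law for the distorted problem) of the K1L one-level split (`stub_oneLevelL_IW`, route
`SolenoidalFractalHomogenisation`, cell `ad-ideate`, tenure rulings D24-6′/D24-7, lead memo
`onelevel-L3-ledger-architecture.md` §3).

## Mathlib / tree search

Tree: `Visc4`, `viscAdj`, `viscOp`, `NearIso`, `majorTranspose` (`PassiveVectorTensor`), the flat class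
`IsWeakTensorPassiveVectorOn` and its test class `IsSpaceTimeTest` (jointly `C^∞` lift), `partialDeriv`
calculus (`partialDeriv_const_smul`, `partialDeriv_apply_coord`, `partialDeriv_comm`,
`IsSmoothSpaceTimeOn.partialDeriv`, `iterPartialDeriv` / `IsSmoothSpaceTimeOn.iterPartialDeriv` of `TorusDerivBounds`), `exists_lipschitz_time_of_isSpaceTimeTest`
(`PassiveVectorTensorRestart`); no distorted / variable-coefficient vector class exists (`rg distort`,
`rg viscAdjVar`, `rg "Matrix d d ℝ" Literature/Analysis/FluidPDE`: only the Lagrangian-carrier files of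
the Summit, which produce `∇X`). Mathlib: `Matrix.mulVec`, `WithLp.toLp/ofLp` (no `EuclideanSpace`-valued
matrix action with simp-normal form beyond `Matrix.toLpLin`, avoided here to keep junk-free unfolding).

## References

* S. Armstrong, V. Vicol, *Anomalous diffusion by fractal homogenization*, Ann. PDE 11 (2025) /
  arXiv:2305.05048, §4.1 (the distortion matrix `s_{m−1}`, the equation for `T_{m−1}`), PDF p. 34. [`ArmstrongVicol2025`]
* M. Giaquinta, *Multiple integrals in the calculus of variations and nonlinear elliptic systems*
  (Princeton 1983), Ch. III §2 (2.1)–(2.3) (variable-coefficient systems in divergence form). [`Giaquinta1983MultipleIntegrals`]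
* U. Frisch, *Turbulence* (CUP 1995), §9.6.3 eq. (9.57) p. 233. [`Frisch1995Turbulence`]
* R. J. DiPerna, P.-L. Lions, Invent. Math. 98 (1989), §II.1 (12)–(14) (weak solutions of linear
  transport equations, test classes). [`DiPernaLions1989`]
-/

noncomputable section

open MeasureTheory Set Filter Function TopologicalSpace
open scoped ENNReal NNReal InnerProductSpace ContDiff Topology

namespace Literature.Analysis.FluidPDE

namespace Torus

variable {d : Type*} [Fintype d] [DecidableEq d]

/-! ## §1 The conjugated tensor `𝔸^G` -/

/-- **The conjugated (distorted) viscosity tensor** `𝔸^M` of a constant fourth-order tensor `𝔸` by a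
matrix `M` (at a point): `(𝔸^M) i c j e = Σ_{a,b} M c a * 𝔸 i a j b * M e b` — the coefficient tensor of
the divergence-form operator obtained from `𝓛_𝔸` under the change of variables `x = X(y)` with
`M = (∇X(y))⁻¹` (`(∂_a u_j) ∘ X = Σ_c M_{ca} ∂_c ũ_j`); Armstrong–Vicol's `K_m + s_{m−1}`,
`s_{m−1} = K_m ξ̂ (∇X ∘ X⁻¹ − I)`, is the scalar (matrix-diffusivity) prototype.
[cite: ArmstrongVicol2025, §4.1 (s_{m−1}, T_{m−1}), PDF p. 34] [cite: Giaquinta1983MultipleIntegrals, Ch. III §2 eq. (2.1)-(2.3)] -/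
def Visc4.conj (M : Matrix d d ℝ) (𝔸 : Visc4 d) : Visc4 d :=
  fun i c j e => ∑ a, ∑ b, M c a * 𝔸 i a j b * M e b

omit [DecidableEq d] in
/-- Unfolding of `Visc4.conj`. [cite: Giaquinta1983MultipleIntegrals, Ch. III §2 eq. (2.1)-(2.3)] -/
theorem Visc4.conj_apply (M : Matrix d d ℝ) (𝔸 : Visc4 d) (i c j e : d) :
    Visc4.conj M 𝔸 i c j e = ∑ a, ∑ b, M c a * 𝔸 i a j b * M e b := rfl

/-- Conjugation by the identity matrix does nothing: `𝔸^1 = 𝔸`.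
[cite: Giaquinta1983MultipleIntegrals, Ch. III §2 eq. (2.1)-(2.3)] -/
@[simp] theorem Visc4.conj_one (𝔸 : Visc4 d) : Visc4.conj (1 : Matrix d d ℝ) 𝔸 = 𝔸 := by
  funext i c j e
  simp only [Visc4.conj, Matrix.one_apply, ite_mul, one_mul, zero_mul, mul_ite, mul_one, mul_zero,
    Finset.sum_ite_eq, Finset.mem_univ, if_true]

omit [DecidableEq d] in
/-- Conjugation is additive in the tensor. [cite: Giaquinta1983MultipleIntegrals, Ch. III §2 eq. (2.1)-(2.3)] -/
theorem Visc4.conj_add (M : Matrix d d ℝ) (𝔸 𝔹 : Visc4 d) :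
    Visc4.conj M (𝔸 + 𝔹) = Visc4.conj M 𝔸 + Visc4.conj M 𝔹 := by
  funext i c j e
  simp only [Visc4.conj, Pi.add_apply, mul_add, add_mul, Finset.sum_add_distrib]

omit [DecidableEq d] in
/-- Conjugation is homogeneous in the tensor. [cite: Giaquinta1983MultipleIntegrals, Ch. III §2 eq. (2.1)-(2.3)] -/
theorem Visc4.conj_smul (M : Matrix d d ℝ) (r : ℝ) (𝔸 : Visc4 d) :
    Visc4.conj M (r • 𝔸) = r • Visc4.conj M 𝔸 := by
  funext i c j e
  simp only [Visc4.conj, Pi.smul_apply, smul_eq_mul, Finset.mul_sum]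
  exact Finset.sum_congr rfl fun a _ => Finset.sum_congr rfl fun b _ => by ring

omit [DecidableEq d] in
/-- Conjugation commutes with the major transposition `(i a) ↔ (j b)` (the adjoint tensor):
`(majorTranspose 𝔸)^M = majorTranspose (𝔸^M)`. [cite: Giaquinta1983MultipleIntegrals, Ch. III §2 eq. (2.1)-(2.3)] -/
theorem Visc4.conj_majorTranspose (M : Matrix d d ℝ) (𝔸 : Visc4 d) :
    Visc4.conj M (majorTranspose 𝔸) = majorTranspose (Visc4.conj M 𝔸) := by
  funext i c j e
  simp only [Visc4.conj, majorTranspose]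
  rw [Finset.sum_comm]
  exact Finset.sum_congr rfl fun a _ => Finset.sum_congr rfl fun b _ => by ring

/-! ## §2 Distorted fields `y ↦ G(y) v(y)` -/

/-- **The `G`-distorted field** `y ↦ G(y) v(y)` of a vector field `v` on the torus by a matrix field
`G` (the pull-back `X^* u = (∇X)⁻¹ (u ∘ X)` of `u` by the flow, when `v = u ∘ X`, `G = (∇X)⁻¹`):
the Lagrangian-coordinate form of the solenoidality constraint is `∇·(G v) = 0`.
[cite: ArmstrongVicol2025, §4.1 (s_{m−1}, T_{m−1}), PDF p. 34] -/
def distort (G : UnitAddTorus d → Matrix d d ℝ) (v : UnitAddTorus d → EuclideanSpace ℝ d) :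
    UnitAddTorus d → EuclideanSpace ℝ d :=
  fun y => WithLp.toLp 2 ((G y).mulVec (WithLp.ofLp (v y)))

omit [DecidableEq d] in
/-- Coordinates of the distorted field: `(G v)(y)_c = Σ_a G(y)_{ca} v(y)_a`.
[cite: ArmstrongVicol2025, §4.1 (s_{m−1}, T_{m−1}), PDF p. 34] -/
theorem distort_apply (G : UnitAddTorus d → Matrix d d ℝ) (v : UnitAddTorus d → EuclideanSpace ℝ d)
    (y : UnitAddTorus d) (c : d) : distort G v y c = ∑ a, G y c a * v y a := by
  simp only [distort, PiLp.toLp_apply, Matrix.mulVec, dotProduct]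

/-- The identity matrix field does not distort: `distort 1 v = v`.
[cite: ArmstrongVicol2025, §4.1 (s_{m−1}, T_{m−1}), PDF p. 34] -/
@[simp] theorem distort_one (v : UnitAddTorus d → EuclideanSpace ℝ d) :
    distort (fun _ => (1 : Matrix d d ℝ)) v = v := by
  funext y
  simp only [distort, Matrix.one_mulVec, WithLp.toLp_ofLp]

omit [DecidableEq d] in
/-- `distort` is additive in the field. [cite: ArmstrongVicol2025, §4.1 (s_{m−1}, T_{m−1}), PDF p. 34] -/
theorem distort_add (G : UnitAddTorus d → Matrix d d ℝ) (u v : UnitAddTorus d → EuclideanSpace ℝ d) :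
    distort G (u + v) = distort G u + distort G v := by
  funext y
  simp only [distort, Pi.add_apply, WithLp.ofLp_add, Matrix.mulVec_add, WithLp.toLp_add]

omit [DecidableEq d] in
/-- `distort` commutes with scalars. [cite: ArmstrongVicol2025, §4.1 (s_{m−1}, T_{m−1}), PDF p. 34] -/
theorem distort_smul (G : UnitAddTorus d → Matrix d d ℝ) (r : ℝ) (v : UnitAddTorus d → EuclideanSpace ℝ d) :
    distort G (r • v) = r • distort G v := by
  funext y
  simp only [distort, Pi.smul_apply, WithLp.ofLp_smul, Matrix.mulVec_smul, WithLp.toLp_smul]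

/-! ## §3 The divergence-form test operator with variable coefficients -/

/-- **The divergence-form adjoint viscous operator with a `y`-dependent tensor** `𝔹 : T^d → Visc4 d`
applied to a (smooth) vector test field:
`(viscAdjVar 𝔹 Ψ)(y)_j = Σ_{i,c,e} ∂_e ( 𝔹(y) i c j e · (∂_c Ψ)(y)_i )` — the operator `φ ↦ 𝓛^{𝔹,*}φ`
with `∫ ⟨∂_c(𝔹_{icje} ∂_e w_j), φ_i⟩ = ∫ ⟨w, 𝓛^{𝔹,*} φ⟩` after two integrations by parts on the torus
(all derivatives on the test side, as the weak formulation of an `L²` solution requires). With the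
constant field `𝔹 ≡ 𝔸` it is `viscAdj 𝔸` (`viscAdjVar_const`); with `𝔹 = 𝔸^{G(y)}` it is the viscous term
of the Lagrangian-coordinate (distorted) problem. Assembled from its coordinates on the standard basis.
[cite: Giaquinta1983MultipleIntegrals, Ch. III §2 eq. (2.1)-(2.3)] [cite: Frisch1995Turbulence, §9.6.3 eq. (9.57) p. 233] -/
def viscAdjVar (𝔹 : UnitAddTorus d → Visc4 d) (Ψ : UnitAddTorus d → EuclideanSpace ℝ d)
    (x : UnitAddTorus d) : EuclideanSpace ℝ d :=
  ∑ j, (∑ i, ∑ c, ∑ e, FunctionSpaces.Torus.partialDeriv e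
      (fun y => 𝔹 y i c j e * (FunctionSpaces.Torus.partialDeriv c Ψ y) i) x) •
    EuclideanSpace.single j (1 : ℝ)

/-- Coordinates of `viscAdjVar`: `(𝓛^{𝔹,*} Ψ)(x)_l = Σ_{i,c,e} ∂_e(𝔹 i c l e · (∂_c Ψ)_i)(x)` (unfolding).
[cite: Giaquinta1983MultipleIntegrals, Ch. III §2 eq. (2.1)-(2.3)] -/
theorem viscAdjVar_apply (𝔹 : UnitAddTorus d → Visc4 d) (Ψ : UnitAddTorus d → EuclideanSpace ℝ d)
    (x : UnitAddTorus d) (l : d) :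
    viscAdjVar 𝔹 Ψ x l = ∑ i, ∑ c, ∑ e, FunctionSpaces.Torus.partialDeriv e
      (fun y => 𝔹 y i c l e * (FunctionSpaces.Torus.partialDeriv c Ψ y) i) x := by
  rw [viscAdjVar, WithLp.ofLp_sum, Finset.sum_apply]
  simp only [WithLp.ofLp_smul, Pi.smul_apply, PiLp.single_apply, smul_eq_mul, mul_ite,
    mul_one, mul_zero, Finset.sum_ite_eq, Finset.mem_univ, if_true]

/-- **Constant coefficients: `viscAdjVar (fun _ => 𝔸) Ψ = viscAdj 𝔸 Ψ`** on smooth fields (pull the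
constant out, commute the coordinate with the derivative, and exchange the two partial derivatives).
[cite: Frisch1995Turbulence, §9.6.3 eq. (9.57) p. 233] -/
theorem viscAdjVar_const (𝔸 : Visc4 d) {Ψ : UnitAddTorus d → EuclideanSpace ℝ d}
    (hΨ : FunctionSpaces.Torus.IsSmooth Ψ) (x : UnitAddTorus d) :
    viscAdjVar (fun _ => 𝔸) Ψ x = viscAdj 𝔸 Ψ x := by
  ext l
  rw [viscAdjVar_apply, viscAdj_apply]
  refine Finset.sum_congr rfl fun i _ => Finset.sum_congr rfl fun c _ => Finset.sum_congr rfl fun e _ => ?_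
  have h1 : FunctionSpaces.Torus.IsContDiff 1 (FunctionSpaces.Torus.partialDeriv c Ψ) :=
    (hΨ.partialDeriv c).isContDiff (by simp)
  have h2 : FunctionSpaces.Torus.IsContDiff 1 (fun y => (FunctionSpaces.Torus.partialDeriv c Ψ y) i) :=
    ((hΨ.partialDeriv c).apply i).isContDiff (by simp)
  have e1 : (fun y => 𝔸 i c l e * (FunctionSpaces.Torus.partialDeriv c Ψ y) i) =
      (𝔸 i c l e) • (fun y => (FunctionSpaces.Torus.partialDeriv c Ψ y) i) := rfl
  rw [e1, FunctionSpaces.Torus.partialDeriv_const_smul h2, Pi.smul_apply, smul_eq_mul,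
    FunctionSpaces.Torus.partialDeriv_apply_coord h1, FunctionSpaces.Torus.partialDeriv_comm hΨ e c]

/-- The distorted test operator for the identity distortion is the flat one:
`viscAdjVar (fun y => 𝔸^{1}) Ψ = viscAdj 𝔸 Ψ` on smooth fields. [cite: Frisch1995Turbulence, §9.6.3 eq. (9.57) p. 233] -/
theorem viscAdjVar_conj_one (𝔸 : Visc4 d) {Ψ : UnitAddTorus d → EuclideanSpace ℝ d}
    (hΨ : FunctionSpaces.Torus.IsSmooth Ψ) (x : UnitAddTorus d) :
    viscAdjVar (fun _ => Visc4.conj (1 : Matrix d d ℝ) 𝔸) Ψ x = viscAdj 𝔸 Ψ x := by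
  rw [Visc4.conj_one, viscAdjVar_const 𝔸 hΨ]

/-! ## §4 Time-Lipschitz, space-smooth test fields -/

/-- **Space–time test fields that are smooth in space and Lipschitz in time** on `T^d × [0,T)`:
`ψ : ℝ → T^d → F` with every slice `ψ t` smooth; `ψ` and its iterated partial space derivatives of every
order jointly continuous (orders `≤ 2` also recorded separately, in the form the weak integrand uses);
`t ↦ ψ t y` Lipschitz on `[0,T]` uniformly in `y`; and `ψ t = 0` for `t ≥ T'`, some `T' < T`.
This is the test class of the Lagrangian-coordinate (distorted) problem — conjugates `φ ∘ X` of smooth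
tests by a flow that is only Lipschitz in time — and it contains the smooth class `IsSpaceTimeTest`
(`IsSpaceTimeTest.isLipschitzSpaceTimeTest`). The time derivative `timeDeriv ψ t y` then exists for
a.e. `t` (every `y`) and is bounded by the Lipschitz constant.
[cite: DiPernaLions1989, §II.1 (12)–(14)] -/
structure IsLipschitzSpaceTimeTest (T : ℝ) {F : Type*} [NormedAddCommGroup F] [NormedSpace ℝ F]
    (ψ : ℝ → UnitAddTorus d → F) : Prop where
  /-- every time slice is smooth in space -/
  isSmooth_slice : ∀ t, FunctionSpaces.Torus.IsSmooth (ψ t)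
  /-- joint continuity -/
  continuous_uncurry : Continuous (uncurry ψ)
  /-- joint continuity of the first space derivatives -/
  continuous_uncurry_partialDeriv : ∀ j, Continuous (uncurry fun t y => FunctionSpaces.Torus.partialDeriv j (ψ t) y)
  /-- joint continuity of the second space derivatives -/
  continuous_uncurry_partialDeriv₂ : ∀ i j, Continuous (uncurry fun t y =>
    FunctionSpaces.Torus.partialDeriv i (FunctionSpaces.Torus.partialDeriv j (ψ t)) y)
  /-- joint continuity of the iterated partial space derivatives of EVERY order: the slices are
  smooth uniformly in time, so Fourier truncations converge with all derivatives uniformly on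
  `[0,T] × T^d` -/
  continuous_uncurry_iterPartialDeriv : ∀ l : List d, Continuous (uncurry fun t y =>
    FunctionSpaces.Torus.iterPartialDeriv l (ψ t) y)
  /-- Lipschitz in time on `[0,T]`, uniformly in space -/
  lipschitz : ∃ L : ℝ, 0 ≤ L ∧ ∀ t ∈ Icc 0 T, ∀ s ∈ Icc 0 T, ∀ y, ‖ψ t y - ψ s y‖ ≤ L * |t - s|
  /-- compact support in time away from `T` -/
  eventually_zero : ∃ T' < T, ∀ t, T' ≤ t → ψ t = 0

/-- **Smooth space–time test fields are time-Lipschitz space-smooth test fields** (slices of a `C^∞`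
lift are smooth; space derivatives of a `C^∞` lift are `C^∞`, hence jointly continuous; the mean value
inequality in time on the compact `[0,T] × T^d`). [cite: DiPernaLions1989, §II.1 (12)–(14)] -/
theorem _root_.Literature.Analysis.FunctionSpaces.Torus.IsSpaceTimeTest.isLipschitzSpaceTimeTest {T : ℝ}
    {ψ : ℝ → UnitAddTorus d → EuclideanSpace ℝ d}
    (hψ : FunctionSpaces.Torus.IsSpaceTimeTest T ψ) : IsLipschitzSpaceTimeTest T ψ where
  isSmooth_slice := hψ.isSmooth_slice
  continuous_uncurry := hψ.continuous_uncurry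
  continuous_uncurry_partialDeriv j := by
    have h := ((hψ.isSmoothSpaceTimeOn univ).partialDeriv uniqueDiffOn_univ j).continuousOn_stLift
    rw [univ_prod_univ, continuousOn_univ] at h
    exact FunctionSpaces.Torus.continuous_uncurry_of_continuous_stLift h
  continuous_uncurry_partialDeriv₂ i j := by
    have h := (((hψ.isSmoothSpaceTimeOn univ).partialDeriv uniqueDiffOn_univ j).partialDeriv
      uniqueDiffOn_univ i).continuousOn_stLift
    rw [univ_prod_univ, continuousOn_univ] at h
    exact FunctionSpaces.Torus.continuous_uncurry_of_continuous_stLift h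
  continuous_uncurry_iterPartialDeriv l := by
    have h := ((hψ.isSmoothSpaceTimeOn univ).iterPartialDeriv uniqueDiffOn_univ l).continuousOn_stLift
    rw [univ_prod_univ, continuousOn_univ] at h
    exact FunctionSpaces.Torus.continuous_uncurry_of_continuous_stLift h
  lipschitz := exists_lipschitz_time_of_isSpaceTimeTest (T' := T) hψ
  eventually_zero := hψ.2

namespace IsLipschitzSpaceTimeTest

variable {T : ℝ} {F : Type*} [NormedAddCommGroup F] [NormedSpace ℝ F] {ψ : ℝ → UnitAddTorus d → F}

/-- The time slices are `C¹`. [cite: DiPernaLions1989, §II.1 (12)–(14)] -/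
theorem isContDiff_one_slice (hψ : IsLipschitzSpaceTimeTest T ψ) (t : ℝ) :
    FunctionSpaces.Torus.IsContDiff 1 (ψ t) :=
  (hψ.isSmooth_slice t).isContDiff (by simp)

/-- **The time derivative is bounded by the Lipschitz constant** at every `t ∈ (0,T)` (where the slope
bound is two-sided): `‖timeDeriv ψ t y‖ ≤ L`. [cite: DiPernaLions1989, §II.1 (12)–(14)] -/
theorem exists_bound_timeDeriv (hψ : IsLipschitzSpaceTimeTest T ψ) :
    ∃ L : ℝ, 0 ≤ L ∧ ∀ t ∈ Ioo 0 T, ∀ y, ‖FunctionSpaces.Torus.timeDeriv ψ t y‖ ≤ L := by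
  obtain ⟨L, hL0, hL⟩ := hψ.lipschitz
  refine ⟨L, hL0, fun t ht y => ?_⟩
  unfold FunctionSpaces.Torus.timeDeriv
  by_cases hd : DifferentiableAt ℝ (fun τ => ψ τ y) t
  · -- the derivative is the limit of difference quotients, each bounded by `L`
    have hder := hd.hasDerivAt
    rw [hasDerivAt_iff_tendsto_slope] at hder
    have hev : ∀ᶠ s in 𝓝[≠] t, ‖slope (fun τ => ψ τ y) t s‖ ≤ L := by
      have hmem : ∀ᶠ s in 𝓝[≠] t, s ∈ Ioo 0 T := by
        exact mem_nhdsWithin_of_mem_nhds (Ioo_mem_nhds ht.1 ht.2)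
      filter_upwards [hmem, self_mem_nhdsWithin] with s hs hst
      rw [slope_def_module, norm_smul, norm_inv, Real.norm_eq_abs]
      have hts : 0 < |s - t| := abs_pos.2 (sub_ne_zero.2 hst)
      have h1 := hL s (Ioo_subset_Icc_self hs) t (Ioo_subset_Icc_self ht) y
      calc |s - t|⁻¹ * ‖ψ s y - ψ t y‖ ≤ |s - t|⁻¹ * (L * |s - t|) :=
            mul_le_mul_of_nonneg_left h1 (inv_nonneg.2 hts.le)
        _ = L := by field_simp
    have hlim := (continuous_norm.tendsto _).comp hder
    rw [hd.hasDerivAt.deriv]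
    exact le_of_tendsto hlim hev
  · rw [deriv_zero_of_not_differentiableAt hd, norm_zero]
    exact hL0

end IsLipschitzSpaceTimeTest

/-! ## §5 The distorted weak class -/

/-- **Weak passive solenoidal vectors with a `G`-DISTORTED constant viscosity tensor** on
`T^d × [0,T)` — the Lagrangian-coordinate form of `∂ₜu + (b·∇)u + A (u·∇)b + ∇π = 𝓛_𝔸 u`, `∇·u = 0`
after conjugation by a volume-preserving flow with inverse Jacobian `G(t, y)`:
`∂ₜw + (b·∇)w + A (w·∇)b + Gᵀ∇π = 𝓛^{G} w`, `∇·(G w) = 0`, `w(0) = w₀`,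
`(𝓛^{G} w)_i = Σ_{c,j,e} ∂_c((𝔸^G)_{icje} ∂_e w_j)`, `(𝔸^G)_{icje} = Σ_{a,b} G_{ca} 𝔸_{iajb} G_{eb}`.
VERBATIM the unforced class `Torus.IsWeakTensorPassiveVectorOn A T 𝔸 b w₀ w` (measurability,
`w ∈ L^∞(0,T; L²)`, carrier `b ∈ L¹(0,T; L²)` with `|b||w| ∈ L¹` and `∇·b = 0` weakly — the carrier is
the Eulerian/pull-back cell field and stays FLAT-divergence-free) EXCEPT: (i) the constraint is
`∇·(G(t) w(t)) = 0` weakly for a.e. `t`; (ii) the test class is `Torus.IsLipschitzSpaceTimeTest T Ψ`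
(smooth in `y`, Lipschitz in `t`, vanishing near `T`) with `∇·(G(t) Ψ(t)) = 0` for every `t` — the
pressure `Gᵀ∇π` is eliminated exactly by these tests; (iii) the viscous term is the divergence-form
test operator `viscAdjVar (y ↦ 𝔸^{G(t,y)}) (Ψ t)`. No forcing, no ellipticity of `𝔸`, no regularity of
`G` is built in (consumers assume `G` bounded with bounded continuous `y`-derivative, `‖G − 1‖_∞ ≤ δ`).
For `G ≡ 1` every distorted solution is a flat one (`IsWeakTensorPassiveVectorDistortedOn.of_one_toFlat`;
the converse is the flat weak formulation for time-Lipschitz tests). Passive-vector analogue of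
Armstrong–Vicol's Lagrangian-coordinate equation `∂ₜT − ∇·((K_m + s_{m−1})∇T) + b_{m−1}·∇T = 0`.
[cite: ArmstrongVicol2025, §4.1 (s_{m−1}, T_{m−1}), PDF p. 34] [cite: Giaquinta1983MultipleIntegrals, Ch. III §2 eq. (2.1)-(2.3)]
[cite: Frisch1995Turbulence, §9.6.3 eq. (9.57) p. 233] [cite: DiPernaLions1989, §II.1 (12)–(14)] -/
structure IsWeakTensorPassiveVectorDistortedOn (A : ℝ) (T : ℝ) (𝔸 : Visc4 d)
    (b : ℝ → UnitAddTorus d → EuclideanSpace ℝ d) (G : ℝ → UnitAddTorus d → Matrix d d ℝ)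
    (w₀ : UnitAddTorus d → EuclideanSpace ℝ d) (w : ℝ → UnitAddTorus d → EuclideanSpace ℝ d) : Prop where
  /-- `w` is a.e. strongly measurable on `(0,T) × T^d` (through the space–time lift). -/
  aestronglyMeasurable :
    AEStronglyMeasurable (FunctionSpaces.Torus.stLift w) (volume.restrict (Ioo 0 T ×ˢ univ))
  /-- `b` is a.e. strongly measurable on `(0,T) × T^d` (through the space–time lift). -/
  aestronglyMeasurable_carrier :
    AEStronglyMeasurable (FunctionSpaces.Torus.stLift b) (volume.restrict (Ioo 0 T ×ˢ univ))
  /-- `w ∈ L^∞(0,T; L²(T^d))`: `∫ ‖w(t)‖² ≤ C` for a.e. `t ∈ (0,T)`. -/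
  ae_lintegral_sq_le : ∃ C : ℝ≥0, ∀ᵐ t ∂(volume.restrict (Ioo 0 T)), ∫⁻ x, ‖w t x‖ₑ ^ 2 ≤ C
  /-- `b ∈ L¹(0,T; L²(T^d))`. -/
  lintegral_carrier_lt_top : ∫⁻ t in Ioo 0 T, (∫⁻ x, ‖b t x‖ₑ ^ 2) ^ (1 / 2 : ℝ) < ⊤
  /-- `|b| |w| ∈ L¹((0,T) × T^d)`. -/
  lintegral_mul_lt_top : ∫⁻ t in Ioo 0 T, ∫⁻ x, ‖b t x‖ₑ * ‖w t x‖ₑ < ⊤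
  /-- `∇·b(t) = 0` weakly (FLAT divergence), for a.e. `t ∈ (0,T)`. -/
  ae_isWeaklyDivFree_carrier :
    ∀ᵐ t ∂(volume.restrict (Ioo 0 T)), FunctionSpaces.Torus.IsWeaklyDivFree (b t)
  /-- `∇·(G(t) w(t)) = 0` weakly, for a.e. `t ∈ (0,T)` (the distorted constraint). -/
  ae_isWeaklyDivFree_distort :
    ∀ᵐ t ∂(volume.restrict (Ioo 0 T)), FunctionSpaces.Torus.IsWeaklyDivFree (distort (G t) (w t))
  /-- The weak formulation with datum, for time-Lipschitz space-smooth tests with `∇·(G Ψ) = 0`: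
  `∫₀ᵀ∫ (⟪w, ∂ₜΨ + (b·∇)Ψ + 𝓛^{G,*}Ψ⟫ + A ⟪b, (w·∇)Ψ⟫) + ∫⟪w₀, Ψ(0)⟫ = 0`. -/
  weak_eq : ∀ Ψ : ℝ → UnitAddTorus d → EuclideanSpace ℝ d,
    IsLipschitzSpaceTimeTest T Ψ → (∀ t, FunctionSpaces.Torus.IsDivFree (distort (G t) (Ψ t))) →
    (∫ t in Ioo 0 T, ∫ x, (⟪w t x, FunctionSpaces.Torus.timeDeriv Ψ t x +
          FunctionSpaces.Torus.convect (b t) (Ψ t) x +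
          viscAdjVar (fun y => Visc4.conj (G t y) 𝔸) (Ψ t) x⟫_ℝ +
        A * ⟪b t x, FunctionSpaces.Torus.convect (w t) (Ψ t) x⟫_ℝ)) +
      ∫ x, ⟪w₀ x, Ψ 0 x⟫_ℝ = 0

namespace IsWeakTensorPassiveVectorDistortedOn

variable {A T : ℝ} {𝔸 : Visc4 d} {b w : ℝ → UnitAddTorus d → EuclideanSpace ℝ d}
  {G : ℝ → UnitAddTorus d → Matrix d d ℝ} {w₀ : UnitAddTorus d → EuclideanSpace ℝ d}

/-! ### Kinematic API (verbatim from the flat class) -/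

/-- Joint measurability of `w` on `(0,T) × T^d`. [cite: DiPernaLions1989, §II.1 (12)–(14)] -/
theorem aestronglyMeasurable_uncurry (h : IsWeakTensorPassiveVectorDistortedOn A T 𝔸 b G w₀ w) :
    AEStronglyMeasurable (uncurry w) (((volume : Measure ℝ).restrict (Ioo 0 T)).prod volume) := by
  rw [← volume_restrict_prod_eq]
  exact FunctionSpaces.Torus.aestronglyMeasurable_uncurry_of_stLift_restrict h.aestronglyMeasurable

/-- Joint measurability of the carrier `b` on `(0,T) × T^d`. [cite: DiPernaLions1989, §II.1 (12)–(14)] -/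
theorem aestronglyMeasurable_uncurry_carrier (h : IsWeakTensorPassiveVectorDistortedOn A T 𝔸 b G w₀ w) :
    AEStronglyMeasurable (uncurry b) (((volume : Measure ℝ).restrict (Ioo 0 T)).prod volume) := by
  rw [← volume_restrict_prod_eq]
  exact FunctionSpaces.Torus.aestronglyMeasurable_uncurry_of_stLift_restrict h.aestronglyMeasurable_carrier

/-- Slices are measurable for a.e. `t`. [cite: DiPernaLions1989, §II.1 (12)–(14)] -/
theorem ae_aestronglyMeasurable_slice (h : IsWeakTensorPassiveVectorDistortedOn A T 𝔸 b G w₀ w) :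
    ∀ᵐ t ∂(volume.restrict (Ioo 0 T)),
      AEStronglyMeasurable (w t) volume ∧ AEStronglyMeasurable (b t) volume := by
  filter_upwards [h.aestronglyMeasurable_uncurry.prodMk_left,
    h.aestronglyMeasurable_uncurry_carrier.prodMk_left] with t h1 h2
  exact ⟨h1, h2⟩

/-- The `L^∞_t L²_x` bound in `eLpNorm` form. [cite: DiPernaLions1989, §II.1 (12)–(14)] -/
theorem exists_eLpNorm_le (h : IsWeakTensorPassiveVectorDistortedOn A T 𝔸 b G w₀ w) :
    ∃ C : ℝ≥0, ∀ᵐ t ∂(volume.restrict (Ioo 0 T)), eLpNorm (w t) 2 volume ≤ C := by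
  obtain ⟨C, hC⟩ := h.ae_lintegral_sq_le
  refine ⟨NNReal.sqrt C, ?_⟩
  filter_upwards [hC] with t ht
  rw [eLpNorm_eq_lintegral_rpow_enorm_toReal two_ne_zero ENNReal.ofNat_ne_top, ENNReal.toReal_ofNat]
  have h2 : ∫⁻ x, ‖w t x‖ₑ ^ (2 : ℝ) = ∫⁻ x, ‖w t x‖ₑ ^ 2 := by
    refine lintegral_congr fun x => ?_
    rw [← ENNReal.rpow_two]
  rw [h2]
  calc (∫⁻ x, ‖w t x‖ₑ ^ 2) ^ (1 / (2 : ℝ)) ≤ (C : ℝ≥0∞) ^ (1 / (2 : ℝ)) := by gcongr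
    _ = NNReal.sqrt C := by
        rw [← ENNReal.coe_rpow_of_nonneg _ (by norm_num), ← NNReal.sqrt_eq_rpow]

/-- For a.e. `t ∈ (0,T)`, `w t ∈ L²(T^d)`. [cite: DiPernaLions1989, §II.1 (12)–(14)] -/
theorem ae_memLp_two (h : IsWeakTensorPassiveVectorDistortedOn A T 𝔸 b G w₀ w) :
    ∀ᵐ t ∂(volume.restrict (Ioo 0 T)), MemLp (w t) 2 volume := by
  obtain ⟨C, hC⟩ := h.exists_eLpNorm_le
  filter_upwards [hC, h.aestronglyMeasurable_uncurry.prodMk_left] with t ht hm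
  exact ⟨hm, ht.trans_lt ENNReal.coe_lt_top⟩

/-- `w ∈ L¹((0,T) × T^d)`. [cite: DiPernaLions1989, §II.1 (12)–(14)] -/
theorem integrable_uncurry (h : IsWeakTensorPassiveVectorDistortedOn A T 𝔸 b G w₀ w) :
    Integrable (uncurry w) (((volume : Measure ℝ).restrict (Ioo 0 T)).prod volume) := by
  obtain ⟨C, hC⟩ := h.exists_eLpNorm_le
  refine ⟨h.aestronglyMeasurable_uncurry, ?_⟩
  rw [hasFiniteIntegral_iff_enorm, lintegral_prod _ h.aestronglyMeasurable_uncurry.enorm]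
  calc ∫⁻ t in Ioo 0 T, ∫⁻ x, ‖uncurry w (t, x)‖ₑ
      ≤ ∫⁻ _ in Ioo 0 T, (C : ℝ≥0∞) := by
        refine lintegral_mono_ae ?_
        filter_upwards [hC, h.aestronglyMeasurable_uncurry.prodMk_left] with t ht hm
        calc ∫⁻ x, ‖uncurry w (t, x)‖ₑ = eLpNorm (w t) 1 volume := by
              rw [eLpNorm_one_eq_lintegral_enorm]; rfl
          _ ≤ eLpNorm (w t) 2 volume := eLpNorm_le_eLpNorm_of_exponent_le (by norm_num) hm
          _ ≤ C := ht
    _ < ⊤ := by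
        rw [setLIntegral_const]
        exact ENNReal.mul_lt_top ENNReal.coe_lt_top measure_Ioo_lt_top

/-! ### The identity distortion: bridge to the flat class -/

/-- **`G ≡ 1`: every distorted weak solution is a flat weak solution** (`Torus.IsWeakTensorPassiveVectorOn`):
the constraint `∇·(1 w) = 0` is `∇·w = 0`; a smooth space–time test field is a time-Lipschitz one; on
it `∇·(1 Ψ) = ∇·Ψ` and `viscAdjVar (𝔸^1) = viscAdj 𝔸` slice by slice. (The converse — flat solutions
satisfy the weak formulation for time-Lipschitz tests — is the time-mollification lemma, filed separately.)
[cite: DiPernaLions1989, §II.1 (12)–(14)] [cite: Frisch1995Turbulence, §9.6.3 eq. (9.57) p. 233] -/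
theorem of_one_toFlat (h : IsWeakTensorPassiveVectorDistortedOn A T 𝔸 b (fun _ _ => (1 : Matrix d d ℝ)) w₀ w) :
    IsWeakTensorPassiveVectorOn A T 𝔸 b w₀ w where
  aestronglyMeasurable := h.aestronglyMeasurable
  aestronglyMeasurable_carrier := h.aestronglyMeasurable_carrier
  ae_lintegral_sq_le := h.ae_lintegral_sq_le
  lintegral_carrier_lt_top := h.lintegral_carrier_lt_top
  lintegral_mul_lt_top := h.lintegral_mul_lt_top
  ae_isWeaklyDivFree_carrier := h.ae_isWeaklyDivFree_carrier
  ae_isWeaklyDivFree := by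
    filter_upwards [h.ae_isWeaklyDivFree_distort] with t ht
    rwa [distort_one] at ht
  weak_eq Ψ hΨ hΨdiv := by
    have hdiv' : ∀ t, FunctionSpaces.Torus.IsDivFree (distort ((fun (_ : ℝ) (_ : UnitAddTorus d) =>
        (1 : Matrix d d ℝ)) t) (Ψ t)) := fun t => by
      rw [show (fun (_ : ℝ) (_ : UnitAddTorus d) => (1 : Matrix d d ℝ)) t = fun _ => 1 from rfl, distort_one]
      exact hΨdiv t
    have key := h.weak_eq Ψ hΨ.isLipschitzSpaceTimeTest hdiv'
    have e : ∀ t x, viscAdjVar (fun y => Visc4.conj ((fun (_ : ℝ) (_ : UnitAddTorus d) => (1 : Matrix d d ℝ)) t y) 𝔸)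
        (Ψ t) x = viscAdj 𝔸 (Ψ t) x := fun t x => viscAdjVar_conj_one 𝔸 (hΨ.isSmooth_slice t) x
    simp only [e] at key
    exact key

end IsWeakTensorPassiveVectorDistortedOn

end Torus

end Literature.Analysis.FluidPDE

end
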